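import Literature.MathematicalPhysics.QuantumFieldTheory.Balaban1983to89.B9Eq387CubeFormCoerciveSmallField
import Literature.MathematicalPhysics.QuantumFieldTheory.Balaban1983to89.B9Eq387IMSLocShapeAdapter

/-!
# `Balaban1983to89.B9Eq387IMSLocSmallField` — T. Bałaban, *Propagators for lattice gauge theories in a background field*, Commun. Math. Phys. **99**
# (1985) 389–434 [Balaban1985BackgroundPropagators] Thm 3.11 p. 416 with (3.26) p. 395, (3.10) p. 392, (3.21)–(3.23) p. 394, and p. 408 («Σ_□ h²_□ = 1»),
# (3.87)–(3.89) p. 409: **ROW L10 (loc) OF THE TIER-P ASSEMBLY ON THE SMALL-BACKGROUND WINDOW — the second half of Thm 3.11 in the cell's form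
# `γ‖x‖² ≤ re⟪x, (D*D + D R(U) D* + aQ(U)†Q(U))x⟫` IS kernel 7's `hloc` binder with `γ₁ = 0`, `γ₀ = γ`, read through the form identity
# `re⟪x, Δ_a^{prin}(U)x⟫ = ‖curl_U x‖² + ‖R(U)D*_U x‖² + a‖Q(U)x‖²` and ne9-leaf-01's currency identity `‖D*_UA‖² − ‖T†A‖² = ‖R(U)D*_UA‖²`**
# — route R2′ STEP B8′ (Tier P by discrete IMS localisation), instance-ledger rows L10 → L11 of the pub-balaban NE9 chain (`t4/ROUTES-NE9.md` v13.45)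

statement-level skeleton of published theorems with citation tags; proofs where landed; nothing here is a claim about the Yang–Mills mass gap

CITATION HEADER (lean-in-tree rule).  Audit cell `pub-balaban`, sub-cell `t4`, BINDER row NE9; filed by NE9 formalisation-swarm LEAF PROVER 06
(`b2b-balaban-t4-ne9-formalise-leaf-06`, gen 72; the S-P6′(α)(β)(γ) lineage, author of `B9Eq387CubeLocalisedProjection.cube_form_ge′`), as a
COMPOSITION BY NAME of the cell's own objects: `B9Thm311SmallFieldCoercivityUniform.exists_coercive_principal_of_small_field_uniform` (NE9 OWNER
t4-ne9-p1 ∕ ne9-leaf lineage, [B9] Thm 3.11 second half with `∃ γ ε₀` before the volume), this lineage's sibling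
`B9Eq387CubeFormCoerciveSmallField.re_inner_laplaceA_principal_eq` ((3.26) in squares: [B5] (1.69) `re_inner_laplaceAK_projR` + (3.10) + (3.8)), and ne9-leaf-01 g86's
`B9Eq387IMSLocShapeAdapter.norm_sq_covDiv_sub_norm_sq_adjoint_T` (p. 414 l. 5–6 «DRD* = DD* − DPD*», at (3.26)'s letters).  CONSUMER BY SHAPE: ne9-leaf-01's
`B9Eq387IMSAssemblyLattice.ims_assembly_lattice ∕ ims_assembly_strong_lattice` (`hloc`), `B9Eq387IMSAssemblySmallField`, `B9Eq387IMSTierPSmallField.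
ims_tierP_small_background` (its one displayed row (loc), at `γ₁ := 0`).  Source READ in the held text [Balaban1985BackgroundPropagators] (journal page =
PDF page + 388): p. 416 Thm 3.11 *«Δ_a … is positive definite»* and its proof's second half *«by (3.86) we get G_□(e^{iηA}) = G_□(1)(I − V(A)G_□(1))⁻¹»*;
p. 395 (3.26) *«Δ_a(U) = Δ(U) + D_U R(U) D*_U + Q*(U)aQ(U) … or simply Δ_a = Δ + DRD* + Q*aQ»*; p. 414 l. 5–6 *«We have DRD* = DD* − DPD*»*; p. 392 (3.10); p. 394 (3.21)–(3.23); p. 408 *«Σ_{□∈𝒟} h²_□ = 1»*; p. 409 (3.87)–(3.89).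
[folklore] bookkeeping; NOTHING of print's estimates is asserted or valued.

WHY (row L10 → L11, LOCATED).  Kernel 7 (`ims_assembly_(strong_)lattice`) assembles GLOBAL coercivity of the bond form
`‖D_UA‖² + ‖D*_UA‖² + a‖Q(U)A‖² − ‖T†A‖²` (`T = D_U(1 − R(U))`, so `‖D*_UA‖² − ‖T†A‖² = ‖R(U)D*_UA‖²` and the form IS (3.26)'s `re⟪A, Δ_a(U)A⟫`
with the principal `Δ(U) = D*D`) from LOCAL coercivity (loc) on the partition cubes `χ_B^z`.  ON THE SMALL-BACKGROUND WINDOW of ne9-leaf-01's Tier P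
(`‖U(b) − 1‖ ≤ ε_U` on EVERY bond) the background is already globally small, and [B9] Thm 3.11's second half — in the tree with `∃ γ ε₀` before
`∀ m U` — bounds `re⟪x, Δ_a^{prin}(U)x⟫` below by `γ‖x‖²` for EVERY `x`, in particular for `x := χ_B^zA`: that IS (loc) with `γ₁ = 0`, `γ₀ = γ`.
HONEST LOCATION: on this window the IMS assembly is EXERCISED, not NEEDED — it returns `γ − b_W − Σb_i`, weaker than the `γ` that went in; the
cube-localised projection `R_□` (S-P6′) and the local axial gauge (S-P4) are the (3.35)-CLASS content of row L10 (plaquette variables `αη²`-small, bond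
variables NOT small) and are NOT used here.  This file exists so that the small-background Tier P composes with Thm 3.11 by ONE `exact`.

WHAT IS PROVED (sorry-free; proof lane — no `def`, no `Prop` placeholder; [folklore]).  (§1, the form identity `re_inner_laplaceA_principal_eq`
`re⟪x, Δ_a^{prin}(U)x⟫ = ‖curl_U x‖² + ‖R(U)(D*_U x)‖² + a‖Qx‖²`, lives in the sibling `B9Eq387CubeFormCoerciveSmallField` §1 and is imported by name.)
* §2 **`hloc_of_principal_coercive`** — a displayed coercivity `hγ : ∀ x, γ‖x‖² ≤ re⟪x, Δ_a^{prin}(U)x⟫` (Thm 3.11's conclusion SHAPE, any `Q`, `0 ≤ a`)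
  gives, for `T = toCLM(D_U ∘ (1 − R(U)))` and EVERY bond field `A`:
  `γ‖A‖² ≤ (‖curl_U A‖² + ‖D*_U A‖² + ‖√a·QA‖²) − ‖T†A‖²` — kernel 7's `hloc` (plain case) at `R := R(U)`, `S := R(U⁻¹)`, `W := T†`;
  **`hloc_of_principal_coercive'`** — the same with the `γ₁`-slot displayed at `γ₁ = 0` (`0·(…) + γ‖A‖² ≤ …`, the strong socket's literal shape).
* §3 **`exists_hloc_small_field_uniform`** — §2 ∘ `exists_coercive_principal_of_small_field_uniform`: `∃ γ ε₀ > 0` (functions of `d, L, η, a, c₀, c₁,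
  M_φ, M_φ′` only) such that for EVERY volume `m`, EVERY background of that theorem's window (its binders VERBATIM: `α ≤ 1∕64`, `hU1`, `hreg`, `ε + ρ′ +
  δ_Q ≤ ε₀`, `U(b) ∈ U1`, `‖U(b) − 1‖ ≤ ε`, `hRS`, the centre-lift `Q′`-closeness `ρ′`, the `Q`-closeness `δ_Q`), EVERY `T = toCLM(D_U ∘ (1 − R(U)))`
  and EVERY `A`: the `hloc` row with `γ₁ = 0`, `γ₀ = γ`, at `Q := Q(U)` (`QtorusW`); **`exists_hloc_small_field_uniform'`** — the same in the STRONG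
  socket's literal shape (`0·(…) + γ‖A‖² ≤ …`).
HONEST SCOPE.  Small-background window ONLY (bond variables `ε`-close to `1` everywhere); `γ₁ = 0` (no kinetic share: the STRONG currency needs the
`U`-derivative∕flat-derivative exchange, not here); Thm 3.11's two `Q`∕`Q′`-closeness letters `ρ′`, `δ_Q` stay DISPLAYED exactly as in the host (their
inhabitants are `B9Eq319CentreLiftL2` ∕ `B9Eq383QSemiLocal` per the host's header); `γ, ε₀` by the host's closed recipe, NO number evaluated; ONE
averaging step.  NOT the (3.35)-class (loc) (S-P4 + S-P6′ + the per-cube gauge reduction — not typed by anyone yet); NOT NE9 (cell pub-balaban: NE9 NOT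
PRINTED ∕ NOT PROVED; «NE9 ⇐ the named binders»; row WALLED ON A MODEL (O-NE9-1; #5 UNRULED); spine PROVED 0∕9; rung (B)+1 on a finite T⁴ — NOT
infinite volume, NOT mass gap, NOT BetaPertH, NOT Clay; HONEST DEPENDENCY: continuum YM on T⁴ ⇐ BetaPertH ∧ nine spine estimates (0/9 proved); BetaPertH ⇐
(D1) ∧ (D4) ∧ CAP+tail; G-an2-4 gates asym, D1 and NE2/3/4).  NEW file; nothing modified.  Net new unproved facts: 0.
-/

noncomputable section

set_option autoImplicit false

open scoped InnerProductSpace ComplexConjugate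

namespace Literature.MathematicalPhysics.QuantumFieldTheory.Balaban1983to89.B9Eq387IMSLocSmallField

open B4Sect5Torus (TSite)
open B7Prop1Explicit (U1 Wcx boxVec)
open B9SectCLatticeCarrier (Bond)
open B9Eq311L2Pairing (WL2)
open B9Eq319QprimeTorus (fineP centre weight)
open B9Eq319Onto (centreFun)
open B11Eq103H1Complex (SiteL2K BondL2K covDerivL2K covDivL2K laplaceALatticeK)
open B9Eq310HessianOperator (adTransportW principalOpK covCurlL2K)
open B9Eq326OperatorAssembly (RofU QprimeW)
open B9Eq315QTorus (perCfg cornerSite QtorusW)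
open B5Eq172FlatCoercivity (hU1_one hreg_one)
open B9Thm311SmallFieldCoercivityUniform (exists_coercive_principal_of_small_field_uniform)
open B9Eq387IMSLocShapeAdapter (norm_sq_covDiv_sub_norm_sq_adjoint_T)
open B9Eq387CubeFormCoerciveSmallField (re_inner_laplaceA_principal_eq)

/-! ## §2 (loc) from a displayed principal coercivity: kernel 7's `hloc` shape with `γ₁ = 0` -/

section Loc

/-- `‖(√a : ℂ) • y‖² = a‖y‖²` for `0 ≤ a`. [folklore] -/
private theorem norm_sq_sqrt_smul {F : Type*} [SeminormedAddCommGroup F] [NormedSpace ℂ F] {a : ℝ} (ha : 0 ≤ a) (y : F) :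
    ‖((Real.sqrt a : ℝ) : ℂ) • y‖ ^ 2 = a * ‖y‖ ^ 2 := by
  rw [norm_smul, mul_pow, Complex.norm_real, Real.norm_eq_abs, abs_of_nonneg (Real.sqrt_nonneg _), Real.sq_sqrt ha]

variable {d : ℕ} (L : ℕ) [NeZero L] (m : Fin d → ℕ)
  {𝔸 : Type*} [NormedRing 𝔸] [NormedAlgebra ℂ 𝔸]
  {W : Type*} [NormedAddCommGroup W] [InnerProductSpace ℂ W] [FiniteDimensional ℂ W] (φ : W ≃ₗ[ℂ] 𝔸)
  (c₀ : ℝ) [Fact (0 < c₀)] (η : ℝ) (U : Bond d (fineP L m) → 𝔸ˣ)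
  (hRS : ∀ (b : Bond d (fineP L m)) (v u : W), ⟪adTransportW φ U b v, u⟫_ℂ = ⟪v, adTransportW φ (fun b => (U b)⁻¹) b u⟫_ℂ)
  {F : Type*} [NormedAddCommGroup F] [InnerProductSpace ℂ F] [FiniteDimensional ℂ F]

include hRS in
/-- **(loc) ON A CUBE FIELD FROM [B9] THM 3.11's CONCLUSION SHAPE** — if `γ‖x‖² ≤ re⟪x, (D*D + D R(U) D* + aQ†Q)x⟫` for every `x` (the displayed `hγ`:
the second half of Thm 3.11 in the cell's form, ANY `Q`, `0 ≤ a`), then for `T = toCLM(D_U ∘ (1 − R(U)))` and EVERY bond field `A`: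
`γ‖A‖² ≤ (‖curl_U A‖² + ‖D*_U A‖² + ‖√a·QA‖²) − ‖T†A‖²` — kernel 7's `hloc` (plain case `γ₁ = 0`) at `R := R(U)`, `S := R(U⁻¹)`, `W := T†`; the sibling's §1 plus
ne9-leaf-01's currency identity `‖D*_UA‖² − ‖T†A‖² = ‖R(U)D*_UA‖²`. [folklore] [cite: Balaban1985BackgroundPropagators, Thm 3.11 p.416, (3.26) p.395, p.408 «Σ h²_□ = 1», (3.87)–(3.89) p.409] -/
theorem hloc_of_principal_coercive (Q : BondL2K ℂ d (fineP L m) c₀ W →ₗ[ℂ] F) {a γ : ℝ} (ha : 0 ≤ a)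
    (hγ : ∀ x : BondL2K ℂ d (fineP L m) c₀ W, γ * ‖x‖ ^ 2 ≤
      RCLike.re ⟪x, laplaceALatticeK ((η : ℂ))⁻¹ (adTransportW φ U) (adTransportW φ fun b => (U b)⁻¹) (principalOpK φ η U)
        (RofU L m φ η U (c₀ := c₀)) Q a x⟫_ℂ)
    (T : SiteL2K ℂ d (fineP L m) c₀ W →L[ℂ] BondL2K ℂ d (fineP L m) c₀ W)
    (hT : T = LinearMap.toContinuousLinearMap
      (covDerivL2K ℂ c₀ ((η : ℂ))⁻¹ (adTransportW φ U) ∘ₗ (LinearMap.id - RofU L m φ η U (c₀ := c₀))))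
    (A : BondL2K ℂ d (fineP L m) c₀ W) :
    γ * ‖A‖ ^ 2 ≤
      (‖covCurlL2K ℂ c₀ ((η : ℂ))⁻¹ (adTransportW φ U) A‖ ^ 2 + ‖covDivL2K ℂ c₀ ((η : ℂ))⁻¹ (adTransportW φ fun b => (U b)⁻¹) A‖ ^ 2 +
          ‖((Real.sqrt a : ℝ) : ℂ) • Q A‖ ^ 2) - ‖ContinuousLinearMap.adjoint T A‖ ^ 2 := by
  have h := hγ A
  rw [re_inner_laplaceA_principal_eq L m φ c₀ η U hRS Q a A] at h
  have hid := norm_sq_covDiv_sub_norm_sq_adjoint_T L m φ c₀ η U hRS T hT A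
  rw [norm_sq_sqrt_smul ha]
  linarith

include hRS in
/-- **The same in the STRONG socket's literal shape at `γ₁ = 0`**: `0·(‖curl_U A‖² + ‖D*_U A‖² + ‖√a·QA‖²) + γ‖A‖² ≤ (…) − ‖T†A‖²` — the `hloc` binder of
`ims_assembly_strong_lattice` ∕ `ims_tierP_small_background` read at `γ₁ := 0`, `γ₀ := γ`. [folklore]
[cite: Balaban1985BackgroundPropagators, Thm 3.11 p.416, (3.26) p.395, (3.87)–(3.89) p.409] -/
theorem hloc_of_principal_coercive' (Q : BondL2K ℂ d (fineP L m) c₀ W →ₗ[ℂ] F) {a γ : ℝ} (ha : 0 ≤ a)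
    (hγ : ∀ x : BondL2K ℂ d (fineP L m) c₀ W, γ * ‖x‖ ^ 2 ≤
      RCLike.re ⟪x, laplaceALatticeK ((η : ℂ))⁻¹ (adTransportW φ U) (adTransportW φ fun b => (U b)⁻¹) (principalOpK φ η U)
        (RofU L m φ η U (c₀ := c₀)) Q a x⟫_ℂ)
    (T : SiteL2K ℂ d (fineP L m) c₀ W →L[ℂ] BondL2K ℂ d (fineP L m) c₀ W)
    (hT : T = LinearMap.toContinuousLinearMap
      (covDerivL2K ℂ c₀ ((η : ℂ))⁻¹ (adTransportW φ U) ∘ₗ (LinearMap.id - RofU L m φ η U (c₀ := c₀))))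
    (A : BondL2K ℂ d (fineP L m) c₀ W) :
    0 * (‖covCurlL2K ℂ c₀ ((η : ℂ))⁻¹ (adTransportW φ U) A‖ ^ 2 + ‖covDivL2K ℂ c₀ ((η : ℂ))⁻¹ (adTransportW φ fun b => (U b)⁻¹) A‖ ^ 2 +
          ‖((Real.sqrt a : ℝ) : ℂ) • Q A‖ ^ 2) + γ * ‖A‖ ^ 2 ≤
      (‖covCurlL2K ℂ c₀ ((η : ℂ))⁻¹ (adTransportW φ U) A‖ ^ 2 + ‖covDivL2K ℂ c₀ ((η : ℂ))⁻¹ (adTransportW φ fun b => (U b)⁻¹) A‖ ^ 2 +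
          ‖((Real.sqrt a : ℝ) : ℂ) • Q A‖ ^ 2) - ‖ContinuousLinearMap.adjoint T A‖ ^ 2 := by
  rw [zero_mul, zero_add]
  exact hloc_of_principal_coercive L m φ c₀ η U hRS Q ha hγ T hT A

end Loc

/-! ## §3 On the small-background window: (loc) with `γ₁ = 0`, `γ₀ = γ`, `∃ γ ε₀` before the volume -/

section SmallField

variable {d : ℕ} (L : ℕ) [NeZero L] (hL : 1 ≤ L)
  {𝔸 : Type*} [NormedRing 𝔸] [NormedAlgebra ℂ 𝔸] [CompleteSpace 𝔸] [NormOneClass 𝔸]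
  {W : Type*} [NormedAddCommGroup W] [InnerProductSpace ℂ W] [FiniteDimensional ℂ W] (φ : W ≃ₗ[ℂ] 𝔸) {c₀ c₁ : ℝ} [Fact (0 < c₀)] [Fact (0 < c₁)]

/-- **ROW L10 (loc) INHABITED ON THE SMALL-BACKGROUND WINDOW, `γ₁ = 0`** — [B9] Thm 3.11's second half with `γ, ε₀` before the volume
(`exists_coercive_principal_of_small_field_uniform`, binders VERBATIM) composed with §2: `∃ γ ε₀ > 0` (depending on `d, L, η, a, c₀, c₁, M_φ, M_φ′`
only) such that on EVERY lattice `TSite d (L·m)`, for EVERY background `U` of that window (unit-bounded `ε`-small bond variables, `hRS`, `Q(U)`'s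
data `α ≤ 1∕64`, `hU1`, `hreg`, the centre-lift `Q′`-closeness `ρ′` and the `Q`-closeness `δ_Q` with `ε + ρ′ + δ_Q ≤ ε₀`), EVERY
`T = toCLM(D_U ∘ (1 − R(U)))` and EVERY bond field `A`:
`γ‖A‖² ≤ (‖curl_U A‖² + ‖D*_U A‖² + ‖√a·Q(U)A‖²) − ‖T†A‖²`.  On this window the IMS assembly is exercised, not needed (HONEST LOCATION above).
[cite: Balaban1985BackgroundPropagators, Thm 3.11 p.416, (3.82)–(3.86) p.407, (3.26) p.395, p.408, (3.87)–(3.89) p.409; Balaban1984PropagatorsI, Prop. 1.1 (1.90) p.33] -/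
theorem exists_hloc_small_field_uniform {η : ℝ} (hη : η ≠ 0) {a : ℝ} (ha : 0 < a) {Mφ Mφ' : ℝ} (hMφ : 0 ≤ Mφ)
    (hMφ' : 0 ≤ Mφ') (hφ : ∀ w, ‖φ w‖ ≤ Mφ * ‖w‖) (hφ' : ∀ X, ‖φ.symm X‖ ≤ Mφ' * ‖X‖) :
    ∃ γ ε₀ : ℝ, 0 < γ ∧ 0 < ε₀ ∧ ∀ (m : Fin d → ℕ) [∀ i, NeZero (fineP L m i)]
      (U : Bond d (fineP L m) → 𝔸ˣ) {α : ℝ} (hα1 : α ≤ 1 / 64)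
      (hU1 : ∀ (x : B7Prop1Explicit.Site d) (κ : Fin d), perCfg (fineP L m) U x κ ∈ U1 𝔸)
      (hreg : ∀ (y : TSite d m) (κ : Fin d) (r : Fin d → Fin L), ‖((Wcx L (perCfg (fineP L m) U) (cornerSite L y) κ (boxVec L r) : 𝔸ˣ) : 𝔸) - 1‖ ≤ α)
      {ε ρ' δQ : ℝ}, 0 ≤ ε → 0 ≤ ρ' → 0 ≤ δQ → ε + ρ' + δQ ≤ ε₀ →
      (∀ b, U b ∈ U1 𝔸) → (∀ b, ‖(U b : 𝔸) - 1‖ ≤ ε) →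
      (∀ (b : Bond d (fineP L m)) (v u : W), ⟪adTransportW φ U b v, u⟫_ℂ = ⟪v, adTransportW φ (fun b => (U b)⁻¹) b u⟫_ℂ) →
      (∀ l : SiteL2K ℂ d (fineP L m) c₀ W,
        ‖(WL2.equiv ℂ (fun _ : TSite d (fineP L m) => c₀) W).symm (centreFun (weight L m) (centre L m)
          (QprimeW L m φ U l - QprimeW L m φ (fun _ : Bond d (fineP L m) => (1 : 𝔸ˣ)) l))‖ ≤ ρ' * ‖l‖) →
      (∀ x : BondL2K ℂ d (fineP L m) c₀ W, ‖QtorusW L m hL φ U hα1 hU1 hreg (c₁ := c₁) x -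
        QtorusW L m hL φ (fun _ => 1) (show (0 : ℝ) ≤ 1 / 64 by norm_num) (hU1_one L m) (hreg_one L m) (c₁ := c₁) x‖ ≤ δQ * ‖x‖) →
      ∀ (T : SiteL2K ℂ d (fineP L m) c₀ W →L[ℂ] BondL2K ℂ d (fineP L m) c₀ W),
        T = LinearMap.toContinuousLinearMap
          (covDerivL2K ℂ c₀ ((η : ℂ))⁻¹ (adTransportW φ U) ∘ₗ (LinearMap.id - RofU L m φ η U (c₀ := c₀))) →
      ∀ A : BondL2K ℂ d (fineP L m) c₀ W, γ * ‖A‖ ^ 2 ≤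
        (‖covCurlL2K ℂ c₀ ((η : ℂ))⁻¹ (adTransportW φ U) A‖ ^ 2 + ‖covDivL2K ℂ c₀ ((η : ℂ))⁻¹ (adTransportW φ fun b => (U b)⁻¹) A‖ ^ 2 +
            ‖((Real.sqrt a : ℝ) : ℂ) • QtorusW L m hL φ U hα1 hU1 hreg (c₁ := c₁) A‖ ^ 2) - ‖ContinuousLinearMap.adjoint T A‖ ^ 2 := by
  obtain ⟨γ, ε₀, hγ, hε₀, H⟩ :=
    exists_coercive_principal_of_small_field_uniform L hL φ (c₀ := c₀) (c₁ := c₁) hη ha hMφ hMφ' hφ hφ'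
  refine ⟨γ, ε₀, hγ, hε₀, ?_⟩
  intro m _ U α hα1 hU1 hreg ε ρ' δQ hε hρ' hδQ ht hUb hUε hRS hQ' hQ T hT A
  exact hloc_of_principal_coercive L m φ c₀ η U hRS _ ha.le
    (H m U hα1 hU1 hreg hε hρ' hδQ ht hUb hUε hRS hQ' hQ) T hT A

/-- **The same in the STRONG socket's literal shape at `γ₁ = 0`** — `exists_coercive_principal_of_small_field_uniform` ∘ §2′: the conclusion reads
`0·(‖curl_U A‖² + ‖D*_U A‖² + ‖√a·Q(U)A‖²) + γ‖A‖² ≤ (…) − ‖T†A‖²`, i.e. `ims_assembly_strong_lattice`'s ∕ `ims_tierP_small_background`'s `_hloc` at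
`γ₁ := 0`, `γ₀ := γ` with NO rewriting at the consumer (ne9-leaf-05 g78's X1 INFO (i)). [folklore]
[cite: Balaban1985BackgroundPropagators, Thm 3.11 p.416, (3.82)–(3.86) p.407, (3.26) p.395, p.408, (3.87)–(3.89) p.409; Balaban1984PropagatorsI, Prop. 1.1 (1.90) p.33] -/
theorem exists_hloc_small_field_uniform' {η : ℝ} (hη : η ≠ 0) {a : ℝ} (ha : 0 < a) {Mφ Mφ' : ℝ} (hMφ : 0 ≤ Mφ)
    (hMφ' : 0 ≤ Mφ') (hφ : ∀ w, ‖φ w‖ ≤ Mφ * ‖w‖) (hφ' : ∀ X, ‖φ.symm X‖ ≤ Mφ' * ‖X‖) :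
    ∃ γ ε₀ : ℝ, 0 < γ ∧ 0 < ε₀ ∧ ∀ (m : Fin d → ℕ) [∀ i, NeZero (fineP L m i)]
      (U : Bond d (fineP L m) → 𝔸ˣ) {α : ℝ} (hα1 : α ≤ 1 / 64)
      (hU1 : ∀ (x : B7Prop1Explicit.Site d) (κ : Fin d), perCfg (fineP L m) U x κ ∈ U1 𝔸)
      (hreg : ∀ (y : TSite d m) (κ : Fin d) (r : Fin d → Fin L), ‖((Wcx L (perCfg (fineP L m) U) (cornerSite L y) κ (boxVec L r) : 𝔸ˣ) : 𝔸) - 1‖ ≤ α)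
      {ε ρ' δQ : ℝ}, 0 ≤ ε → 0 ≤ ρ' → 0 ≤ δQ → ε + ρ' + δQ ≤ ε₀ →
      (∀ b, U b ∈ U1 𝔸) → (∀ b, ‖(U b : 𝔸) - 1‖ ≤ ε) →
      (∀ (b : Bond d (fineP L m)) (v u : W), ⟪adTransportW φ U b v, u⟫_ℂ = ⟪v, adTransportW φ (fun b => (U b)⁻¹) b u⟫_ℂ) →
      (∀ l : SiteL2K ℂ d (fineP L m) c₀ W,
        ‖(WL2.equiv ℂ (fun _ : TSite d (fineP L m) => c₀) W).symm (centreFun (weight L m) (centre L m)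
          (QprimeW L m φ U l - QprimeW L m φ (fun _ : Bond d (fineP L m) => (1 : 𝔸ˣ)) l))‖ ≤ ρ' * ‖l‖) →
      (∀ x : BondL2K ℂ d (fineP L m) c₀ W, ‖QtorusW L m hL φ U hα1 hU1 hreg (c₁ := c₁) x -
        QtorusW L m hL φ (fun _ => 1) (show (0 : ℝ) ≤ 1 / 64 by norm_num) (hU1_one L m) (hreg_one L m) (c₁ := c₁) x‖ ≤ δQ * ‖x‖) →
      ∀ (T : SiteL2K ℂ d (fineP L m) c₀ W →L[ℂ] BondL2K ℂ d (fineP L m) c₀ W),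
        T = LinearMap.toContinuousLinearMap
          (covDerivL2K ℂ c₀ ((η : ℂ))⁻¹ (adTransportW φ U) ∘ₗ (LinearMap.id - RofU L m φ η U (c₀ := c₀))) →
      ∀ A : BondL2K ℂ d (fineP L m) c₀ W,
        0 * (‖covCurlL2K ℂ c₀ ((η : ℂ))⁻¹ (adTransportW φ U) A‖ ^ 2 + ‖covDivL2K ℂ c₀ ((η : ℂ))⁻¹ (adTransportW φ fun b => (U b)⁻¹) A‖ ^ 2 +
            ‖((Real.sqrt a : ℝ) : ℂ) • QtorusW L m hL φ U hα1 hU1 hreg (c₁ := c₁) A‖ ^ 2) + γ * ‖A‖ ^ 2 ≤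
        (‖covCurlL2K ℂ c₀ ((η : ℂ))⁻¹ (adTransportW φ U) A‖ ^ 2 + ‖covDivL2K ℂ c₀ ((η : ℂ))⁻¹ (adTransportW φ fun b => (U b)⁻¹) A‖ ^ 2 +
            ‖((Real.sqrt a : ℝ) : ℂ) • QtorusW L m hL φ U hα1 hU1 hreg (c₁ := c₁) A‖ ^ 2) - ‖ContinuousLinearMap.adjoint T A‖ ^ 2 := by
  obtain ⟨γ, ε₀, hγ, hε₀, H⟩ :=
    exists_coercive_principal_of_small_field_uniform L hL φ (c₀ := c₀) (c₁ := c₁) hη ha hMφ hMφ' hφ hφ'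
  refine ⟨γ, ε₀, hγ, hε₀, ?_⟩
  intro m _ U α hα1 hU1 hreg ε ρ' δQ hε hρ' hδQ ht hUb hUε hRS hQ' hQ T hT A
  exact hloc_of_principal_coercive' L m φ c₀ η U hRS _ ha.le
    (H m U hα1 hU1 hreg hε hρ' hδQ ht hUb hUε hRS hQ' hQ) T hT A

end SmallField

end Literature.MathematicalPhysics.QuantumFieldTheory.Balaban1983to89.B9Eq387IMSLocSmallField

end
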